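import Mathlib.GroupTheory.FiniteAbelian.Basic
import Mathlib.Topology.Algebra.Group.ClosedSubgroup
import Literature.IUT.HodgeTheaters.PuncturedEllipticCoveringsBasic
import Literature.AnabelianGeometry.AbsoluteAnabelian.GaloisSubextensionProofs
import Literature.AnabelianGeometry.AbsoluteAnabelian.AbsTopISemiAbsolute
import HarnessLib

/-!
# [IUTchI] §1 p. 38 / Def. 3.1 (f) p. 63: `Π_{X→} ⊆ Π_C` is OPEN — derived from topological finite
# generation of `Δ_X̲` and closedness of the decomposition group `D_{2ε}` (proofs only)

S. Mochizuki, *Inter-universal Teichmüller theory I*, §1 (kurims May-2020 manuscript p. 38: the arrows of the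
cartesian diagram `Π_{X→} ↪ Π_X̲`, `Π_{C→} ↪ Π_C̲` are "open immersions of profinite groups") and Def. 3.1 (f)
(p. 63: "the data `(X_K, C̲_K, ε̲)` determines … open subgroups `Π_{X̲→_K} ⊆ Π_{C̲→_K} ⊆ Π_{C_F}` … If
`v ∈ V̲^good`, then we shall write `Π_v := Π_{X̲→_v}`") [claim: Mochizuki2012, status: disputed].

`Proofs` companion (theorems only) of abc-iut-L5-t1's frozen `PuncturedEllipticCoverings.lean`, addressing
GAP-LEDGER row G-L5t2g4-1: openness of Def. 1.1's `Π_{X→} := D_{2ε} · jKer` is NOT a field of the frozen interface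
(`piXarrow` is an abstract join, `decomp` carries no closedness, `Δ_X̲` no finite generation) and is carried as the
hypothesis `hX` of `InitialThetaData.goodLocalFrobenioidOfEmb` (p419029, Ex. 3.3 at the datum). This file DERIVES it
from inputs the genuine objects satisfy, all already typed in the tree: (1) two printed claims of p. 38 recorded in
`PuncturedEllipticData.ArrowCoveringClaims` — `jKer_normal` (the quotient `J_X = Π_X̲/jKer` exists: `jKer` is
normalised by `Π_C̲`) and `piXarrow_relindex` (`[Π_C̲ : Π_{X→}] = 2l`; only `≠ 0` is used); (2) topological finite
generation of `Δ_X̲`, supplied from that of `Δ_C` ([AbsTopI] Prop. 2.2 = the tree's predicate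
`FundamentalExtension.GeomTFG`; open subgroups of compact topologically finitely generated groups are such,
`IsTopologicallyFinitelyGenerated.subgroup_isOpen`); (3) closedness of the representative decomposition group
`D_{2ε} ⊆ Π_C` (decomposition groups of cusps are closed subgroups of the profinite `Π_C`).

ROUTE. `modLKer = cl(⁅Δ_X̲,Δ_X̲⁆·Δ_X̲^l)` is closed; `Δ_X̲/modLKer` is abelian of exponent `l` and topologically
finitely generated, hence FINITE (`CommGroup.finite_of_fg_torsion` on the image of a dense finitely generated
subgroup, whose preimage is then closed, hence everything); `modLKer ≤ jKer ≤ Δ_X̲` makes `jKer` a finite union of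
cosets of the closed `modLKer`, hence CLOSED; `Π_{X→} = D_{2ε} · jKer` (a product SET since `D_{2ε} ≤ Π_C̲` normalises
`jKer`) is compact · closed, hence CLOSED; closed of finite index (`[Π_C : Π_{X→}] = 2l·[Π_C : Π_C̲] < ∞`) ⟹ OPEN
(`Subgroup.isOpen_of_isClosed_of_finiteIndex`); likewise `Π_{C→} = D_{2ε} · galKer` (`modLKer ≤ galKer ≤ Δ_C̲`,
`[Δ_C̲ : Δ_X̲] ∣ 2`). The Def. 3.1 (f) corollary (`Π_{X̲→_K} = embK(Π_{X→})`, open immersion `Π_{C_K} ↪ Π_{C_F}`,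
p419870) is the companion `InitialThetaDataArrowOpenProofs.lean`.
MINIMALITY (not formalised): were `Δ_X̲^{ab} ⊗ ℤ/l` an infinite `𝔽_l`-space, the kernel of a discontinuous
functional would be a dense index-`l` subgroup containing `modLKer` compatible with every clause of
`ArrowCoveringClaims`; so openness does not follow from the frozen fields + `ArrowCoveringClaims` alone.
Nothing of the disputed series is asserted; no side is taken; no statement of the paper is strengthened.
-/

namespace Literature.IUT.HodgeTheaters

open Literature.AnabelianGeometry.AbsoluteAnabelian Topology
open scoped Pointwise

universe u

/-! ### Two facts about topological groups -/

section TopologicalGroups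

variable {G : Type*} [Group G] [TopologicalSpace G] [IsTopologicalGroup G]

/-- A subgroup `H` containing a CLOSED subgroup `M` of finite relative index `[H : M] < ∞` is closed: it is
the union of finitely many left cosets `h·M`. (Elementary; used for `modLKer ≤ jKer`.)
[claim: Mochizuki2012, status: disputed] -/
theorem ArrowOpen.isClosed_of_le_of_relIndex_ne_zero {M H : Subgroup G} (hMH : M ≤ H)
    (hM : IsClosed (M : Set G)) (hfi : M.relIndex H ≠ 0) : IsClosed (H : Set G) := by
  classical
  haveI : (M.subgroupOf H).FiniteIndex := ⟨hfi⟩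
  have key : (H : Set G) = ⋃ q : H ⧸ M.subgroupOf H, ((q.out : H) : G) • (M : Set G) := by
    ext x
    simp only [Set.mem_iUnion]
    constructor
    · intro hx
      obtain ⟨m, hm⟩ := QuotientGroup.mk_out_eq_mul (M.subgroupOf H) (⟨x, hx⟩ : H)
      refine ⟨QuotientGroup.mk ⟨x, hx⟩, ⟨((m : H) : G)⁻¹, M.inv_mem (Subgroup.mem_subgroupOf.mp m.2), ?_⟩⟩
      rw [hm]
      simp [smul_eq_mul]
    · rintro ⟨q, y, hy, rfl⟩
      exact H.mul_mem (q.out).2 (hMH hy)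
  rw [key]
  exact isClosed_iUnion_of_finite fun q => hM.smul _

/-- In a topological group `Γ` that is topologically finitely generated, a CLOSED normal subgroup `N`
containing all commutators and all `l`-th powers (`l ≠ 0`) has finite index: the image in `Γ/N` — an abelian
group of exponent `l` — of a dense finitely generated subgroup `Λ` is finitely generated and torsion, hence
finite (`CommGroup.finite_of_fg_torsion`); so `Λ·N`, the preimage of a finite subset of the `T₁` quotient, is
closed, hence equal to `Γ`. (Used for `N = modLKer ⊆ Γ = Δ_X̲`: "`Δ_X̲^{ab} ⊗ ℤ/l` is finite".)
[claim: Mochizuki2012, status: disputed] -/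
theorem ArrowOpen.finiteIndex_of_tfg {Γ : Type*} [Group Γ] [TopologicalSpace Γ] [IsTopologicalGroup Γ]
    (N : Subgroup Γ) [N.Normal] (hN : IsClosed (N : Set Γ)) (hcomm : commutator Γ ≤ N) {l : ℕ}
    (hl : l ≠ 0) (hpow : ∀ x : Γ, x ^ l ∈ N) (htfg : IsTopologicallyFinitelyGenerated Γ) :
    N.FiniteIndex := by
  classical
  obtain ⟨s, hs⟩ := htfg.exists_finset
  set π : Γ →* Γ ⧸ N := QuotientGroup.mk' N with hπ
  have hcommQ : IsMulCommutative (Γ ⧸ N) :=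
    Subgroup.Normal.quotient_commutative_iff_commutator_le.mpr hcomm
  set Λ : Subgroup Γ := Subgroup.closure (s : Set Γ) with hΛ
  set Λbar : Subgroup (Γ ⧸ N) := Λ.map π with hΛbar
  have hΛbar_eq : Λbar = Subgroup.closure ((s.image π : Finset (Γ ⧸ N)) : Set (Γ ⧸ N)) := by
    rw [hΛbar, hΛ, MonoidHom.map_closure, Finset.coe_image]
  haveI : Group.FG Λbar := by
    rw [hΛbar_eq]
    exact Group.closure_finset_fg _
  have htors : Monoid.IsTorsion Λbar := fun x => by
    refine isOfFinOrder_iff_pow_eq_one.mpr ⟨l, Nat.pos_of_ne_zero hl, Subtype.ext ?_⟩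
    obtain ⟨g, hg⟩ := QuotientGroup.mk_surjective (x : Γ ⧸ N)
    rw [Subgroup.coe_pow, Subgroup.coe_one, ← hg, ← QuotientGroup.mk_pow, QuotientGroup.eq_one_iff]
    exact hpow g
  letI : CommGroup Λbar :=
    { (inferInstance : Group Λbar) with
      mul_comm := fun a b => Subtype.ext (hcommQ.is_comm.comm (a : Γ ⧸ N) (b : Γ ⧸ N)) }
  haveI : Finite Λbar := CommGroup.finite_of_fg_torsion Λbar htors
  -- `Λ ⊔ N = π⁻¹(Λ̄)` is closed: `Λ̄` is finite and the quotient by the closed `N` is `T₁`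
  haveI : T1Space (Γ ⧸ N) := QuotientGroup.t1Space_iff.mpr hN
  have hA : (Λ ⊔ N : Subgroup Γ) = Λbar.comap π := by
    rw [hΛbar, Subgroup.comap_map_eq, hπ, QuotientGroup.ker_mk']
  have hAclosed : IsClosed ((Λ ⊔ N : Subgroup Γ) : Set Γ) := by
    rw [hA, Subgroup.coe_comap]
    exact ((Λbar : Set (Γ ⧸ N)).toFinite.isClosed).preimage QuotientGroup.continuous_mk
  -- hence `Λ ⊔ N = Γ` (it is closed and contains the dense `Λ`)
  have hAtop : (Λ ⊔ N : Subgroup Γ) = ⊤ := by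
    refine top_le_iff.mp ?_
    rw [← hs]
    exact Subgroup.topologicalClosure_minimal _ le_sup_left hAclosed
  -- so `Γ / N = Λ̄` is finite
  have hmem : ∀ q : Γ ⧸ N, q ∈ Λbar := by
    intro q
    obtain ⟨g, rfl⟩ := QuotientGroup.mk_surjective q
    have hg : g ∈ (Λ ⊔ N : Subgroup Γ) := hAtop ▸ Subgroup.mem_top g
    rw [hA] at hg
    exact hg
  haveI : Finite (Γ ⧸ N) :=
    Finite.of_surjective (fun x : Λbar => (x : Γ ⧸ N)) fun q => ⟨⟨q, hmem q⟩, rfl⟩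
  exact Subgroup.finiteIndex_of_finite_quotient

end TopologicalGroups

/-! ### `Π_{X→}` is open ([IUTchI] §1 p. 38) -/

namespace PuncturedEllipticData

variable (D : PuncturedEllipticData.{u})

/-- `l ≠ 0` (indeed `l ≥ 5`). ([IUTchI] §1 p.37) [claim: Mochizuki2012, status: disputed] -/
theorem l_ne_zero : D.l ≠ 0 := by
  have := D.five_le
  omega

/-- `Π_X̲ = Π_X ∩ Π_C̲` is open in `Π_C`. ([IUTchI] §1 p.37) [claim: Mochizuki2012, status: disputed] -/
theorem isOpen_piXbar : IsOpen (D.PiXbar : Set D.PiC) := D.isOpen_piX.inter D.isOpen_piCbar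

/-- `Ker(Δ_X̲ ↠ Δ_X̲^{ab} ⊗ ℤ/l) ⊆ Ker(Δ_X̲ ↠ Δ_ε⁺)`, i.e. `modLKer ≤ jKer` (by construction).
([IUTchI] §1 pp.37–38) [claim: Mochizuki2012, status: disputed] -/
theorem modLKer_le_jKer : D.modLKer ≤ D.jKer :=
  (le_sup_left : D.modLKer ≤ D.deltaEpsKer).trans (le_sup_left : D.deltaEpsKer ≤ D.jKer)

/-- `modLKer` is closed in `Π_C` (it is a topological closure). ([IUTchI] §1 p.37)
[claim: Mochizuki2012, status: disputed] -/
theorem isClosed_modLKer : IsClosed (D.modLKer : Set D.PiC) := Subgroup.isClosed_topologicalClosure _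

/-- **`Δ_X̲^{ab} ⊗ ℤ/l` is finite** when `Δ_X̲` is topologically finitely generated: `[Δ_X̲ : modLKer] ≠ 0`.
([IUTchI] §1 p.37: "`Δ_X̲^{ab} ⊗ ℤ/l`", a finite group in print) [claim: Mochizuki2012, status: disputed] -/
theorem modLKer_relIndex_ne_zero_of_tfg (htfg : IsTopologicallyFinitelyGenerated ↥D.DeltaXbar) :
    D.modLKer.relIndex D.DeltaXbar ≠ 0 := by
  set N : Subgroup ↥D.DeltaXbar := D.modLKer.subgroupOf D.DeltaXbar with hN
  have hcomm : commutator ↥D.DeltaXbar ≤ N := by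
    intro x hx
    rw [hN, Subgroup.mem_subgroupOf]
    have hx' : (x : D.PiC) ∈ ⁅D.DeltaXbar, D.DeltaXbar⁆ := by
      rw [← Subgroup.map_subtype_commutator]
      exact ⟨x, hx, rfl⟩
    exact Subgroup.le_topologicalClosure _ (Subgroup.mem_sup_left hx')
  have hpow : ∀ x : ↥D.DeltaXbar, x ^ D.l ∈ N := fun x => by
    rw [hN, Subgroup.mem_subgroupOf, Subgroup.coe_pow]
    exact Subgroup.le_topologicalClosure _
      (Subgroup.mem_sup_right (Subgroup.subset_closure ⟨(x : D.PiC), x.2, rfl⟩))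
  haveI : N.Normal := ⟨fun n hn g => by
    have h1 : g * n * g⁻¹ * n⁻¹ ∈ N :=
      hcomm (Subgroup.commutator_mem_commutator (Subgroup.mem_top g) (Subgroup.mem_top n))
    have h2 : g * n * g⁻¹ = g * n * g⁻¹ * n⁻¹ * n := by group
    rw [h2]
    exact N.mul_mem h1 hn⟩
  have hNc : IsClosed (N : Set ↥D.DeltaXbar) := by
    rw [hN, Subgroup.coe_subgroupOf]
    exact D.isClosed_modLKer.preimage continuous_subtype_val
  haveI : N.FiniteIndex := ArrowOpen.finiteIndex_of_tfg N hNc hcomm D.l_ne_zero hpow htfg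
  exact Subgroup.FiniteIndex.index_ne_zero

/-- `[Δ_X̲ : modLKer] < ∞` ⟹ **`jKer = Ker(Δ_X̲ ↠ Δ_ε⁺)` is CLOSED** (a finite union of cosets of the closed
`modLKer`, since `modLKer ≤ jKer ≤ Δ_X̲`). ([IUTchI] §1 p.38) [claim: Mochizuki2012, status: disputed] -/
theorem isClosed_jKer_of_relIndex_ne_zero (hfi : D.modLKer.relIndex D.DeltaXbar ≠ 0) :
    IsClosed (D.jKer : Set D.PiC) :=
  ArrowOpen.isClosed_of_le_of_relIndex_ne_zero D.modLKer_le_jKer D.isClosed_modLKer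
    fun h0 => hfi (Subgroup.relIndex_eq_zero_of_le_right D.jKer_le_deltaXbar h0)

/-- `Π_{X→} = D_{2ε} · jKer` is CLOSED as soon as `jKer` is closed, `D_{2ε}` is closed (hence compact) and
`D_{2ε}` normalises `jKer` (then the join is the product set `D_{2ε} · jKer`, compact · closed).
([IUTchI] §1 p.38) [claim: Mochizuki2012, status: disputed] -/
theorem isClosed_piXarrow_of_isClosed (hj : IsClosed (D.jKer : Set D.PiC))
    (hdec : IsClosed (D.decomp D.twoε : Set D.PiC))
    (hnorm : D.decomp D.twoε ≤ Subgroup.normalizer (D.jKer : Set D.PiC)) :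
    IsClosed (D.piXarrow : Set D.PiC) := by
  have h : ((D.decomp D.twoε ⊔ D.jKer : Subgroup D.PiC) : Set D.PiC) =
      (D.decomp D.twoε : Set D.PiC) * (D.jKer : Set D.PiC) :=
    Subgroup.coe_mul_of_left_le_normalizer_right _ _ hnorm
  change IsClosed ((D.decomp D.twoε ⊔ D.jKer : Subgroup D.PiC) : Set D.PiC)
  rw [h]
  exact hj.smul_left_of_isCompact hdec.isCompact

/-- A CLOSED `Π_{X→}` of finite index in `Π_C̲` (`ArrowCoveringClaims.piXarrow_relindex`: the index is `2l`) is
OPEN in `Π_C` (`Π_C̲` is open in the compact `Π_C`, so `[Π_C : Π_{X→}] < ∞`; closed subgroups of finite index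
are open). ([IUTchI] §1 p.38) [claim: Mochizuki2012, status: disputed] -/
theorem isOpen_piXarrow_of_isClosed (hcl : IsClosed (D.piXarrow : Set D.PiC))
    (hrel : D.piXarrow.relIndex D.PiCbar ≠ 0) : IsOpen (D.piXarrow : Set D.PiC) := by
  haveI : Finite (D.PiC ⧸ D.PiCbar) := Subgroup.quotient_finite_of_isOpen _ D.isOpen_piCbar
  have h1 : D.PiCbar.index ≠ 0 := Subgroup.index_ne_zero_of_finite
  have h2 : D.piXarrow.index ≠ 0 := by
    rw [← Subgroup.relIndex_mul_index D.piXarrow_le_piCbar]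
    exact mul_ne_zero hrel h1
  haveI : D.piXarrow.FiniteIndex := ⟨h2⟩
  exact D.piXarrow.isOpen_of_isClosed_of_finiteIndex hcl

/-- **`Π_{X→} ⊆ Π_C` is OPEN**, from: `jKer` normalised by `Π_C̲` (claim `jKer_normal` of p. 38),
`[Π_C̲ : Π_{X→}] ≠ 0` (claim `piXarrow_relindex`), `[Δ_X̲ : modLKer] ≠ 0` (finiteness of `Δ_X̲^{ab} ⊗ ℤ/l`)
and closedness of the decomposition group `D_{2ε}`. ([IUTchI] §1 p.38, "open immersions of profinite
groups") [claim: Mochizuki2012, status: disputed] -/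
theorem isOpen_piXarrow_of (hnorm : (D.jKer.subgroupOf D.PiCbar).Normal)
    (hrel : D.piXarrow.relIndex D.PiCbar ≠ 0) (hfi : D.modLKer.relIndex D.DeltaXbar ≠ 0)
    (hdec : IsClosed (D.decomp D.twoε : Set D.PiC)) : IsOpen (D.piXarrow : Set D.PiC) := by
  have hjC : D.jKer ≤ D.PiCbar := D.jKer_le_deltaXbar.trans (D.deltaXbar_le_piXbar.trans D.piXbar_le_piCbar)
  have hn : D.decomp D.twoε ≤ Subgroup.normalizer (D.jKer : Set D.PiC) :=
    ((D.decomp_le D.twoε).trans D.piXbar_le_piCbar).trans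
      ((Subgroup.normal_subgroupOf_iff_le_normalizer hjC).mp hnorm)
  exact D.isOpen_piXarrow_of_isClosed
    (D.isClosed_piXarrow_of_isClosed (D.isClosed_jKer_of_relIndex_ne_zero hfi) hdec hn) hrel

/-- **`Π_{X→} ⊆ Π_C` is OPEN** under the printed claims of p. 38 (`ArrowCoveringClaims`), topological finite
generation of `Δ_X̲`, and closedness of `D_{2ε}`. ([IUTchI] §1 p.38) [claim: Mochizuki2012, status: disputed] -/
theorem isOpen_piXarrow_of_claims (h : D.ArrowCoveringClaims)
    (htfg : IsTopologicallyFinitelyGenerated ↥D.DeltaXbar)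
    (hdec : IsClosed (D.decomp D.twoε : Set D.PiC)) : IsOpen (D.piXarrow : Set D.PiC) :=
  D.isOpen_piXarrow_of h.jKer_normal (by rw [h.piXarrow_relindex]; exact mul_ne_zero two_ne_zero D.l_ne_zero)
    (D.modLKer_relIndex_ne_zero_of_tfg htfg) hdec

/-- `Δ_X̲` is topologically finitely generated as soon as `Δ_C` is ([AbsTopI] Prop. 2.2 for the `k`-core `C`,
the tree's predicate `FundamentalExtension.GeomTFG`): `Δ_X̲ = Π_X̲ ∩ Δ_C` is an open subgroup of the compact
`Δ_C`. ([IUTchI] §1 p.37) [claim: Mochizuki2012, status: disputed] -/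
theorem tfg_deltaXbar_of_geomTFG (hΔ : D.E.GeomTFG) : IsTopologicallyFinitelyGenerated ↥D.DeltaXbar := by
  have hΔ' : IsTopologicallyFinitelyGenerated ↥D.DeltaC := hΔ
  haveI : CompactSpace ↥D.DeltaC := isCompact_iff_compactSpace.mp D.E.isClosed_geom.isCompact
  have hU : IsOpen ((D.DeltaXbar.subgroupOf D.DeltaC : Subgroup ↥D.DeltaC) : Set ↥D.DeltaC) := by
    rw [Subgroup.coe_subgroupOf]
    have hpre : (D.DeltaC.subtype ⁻¹' (D.DeltaXbar : Set D.PiC)) =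
        D.DeltaC.subtype ⁻¹' (D.PiXbar : Set D.PiC) := by
      ext x
      simp only [Set.mem_preimage, SetLike.mem_coe, Subgroup.coe_subtype]
      exact ⟨fun hx => hx.1, fun hx => ⟨hx, x.2⟩⟩
    rw [hpre]
    exact D.isOpen_piXbar.preimage continuous_subtype_val
  have htfg : IsTopologicallyFinitelyGenerated ↥(D.DeltaXbar.subgroupOf D.DeltaC) :=
    IsTopologicallyFinitelyGenerated.subgroup_isOpen hΔ' _ hU
  refine htfg.of_surjective
    { (Subgroup.subgroupOfEquivOfLe (inf_le_right : D.DeltaXbar ≤ D.DeltaC)).toMonoidHom with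
      continuous_toFun := ?_ } (Subgroup.subgroupOfEquivOfLe _).surjective
  exact (continuous_subtype_val.comp continuous_subtype_val).subtype_mk _

/-- **`Π_{X→} ⊆ Π_C` is OPEN** under the printed claims of p. 38, [AbsTopI] Prop. 2.2 for `Δ_C`
(`FundamentalExtension.GeomTFG`), and closedness of `D_{2ε}`. ([IUTchI] §1 p.38 "open immersions of profinite
groups") [claim: Mochizuki2012, status: disputed] -/
theorem isOpen_piXarrow_of_claims_of_geomTFG (h : D.ArrowCoveringClaims) (hΔ : D.E.GeomTFG)
    (hdec : IsClosed (D.decomp D.twoε : Set D.PiC)) : IsOpen (D.piXarrow : Set D.PiC) :=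
  D.isOpen_piXarrow_of_claims h (D.tfg_deltaXbar_of_geomTFG hΔ) hdec

/-! ### `Π_{C→}` is open ([IUTchI] §1 p. 38) — the same route through `galKer ⊇ jKer ⊇ modLKer` -/

/-- `galKer ≤ Π_C̲`. ([IUTchI] §1 p.38) [claim: Mochizuki2012, status: disputed] -/
theorem galKer_le_piCbar' : D.galKer ≤ D.PiCbar := D.galKer_le_deltaCbar.trans D.deltaCbar_le_piCbar

/-- `modLKer ≤ galKer` (by construction: `galKer = jKer ⊔ ⟨Δ_C̲^l⟩`). ([IUTchI] §1 p.38)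
[claim: Mochizuki2012, status: disputed] -/
theorem modLKer_le_galKer : D.modLKer ≤ D.galKer := D.modLKer_le_jKer.trans le_sup_left

/-- `[Δ_C̲ : Δ_X̲] ≠ 0` (it divides `[Π_C : Π_X] = 2`, `Π_X` being normal). ([IUTchI] §1 p.37)
[claim: Mochizuki2012, status: disputed] -/
theorem deltaXbar_relIndex_deltaCbar_ne_zero : D.DeltaXbar.relIndex D.DeltaCbar ≠ 0 := by
  have h : D.DeltaXbar = D.PiX ⊓ D.DeltaCbar := by
    show (D.PiX ⊓ D.PiCbar) ⊓ D.DeltaC = D.PiX ⊓ (D.PiCbar ⊓ D.DeltaC)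
    exact inf_assoc _ _ _
  haveI := D.piX_normal
  rw [h, Subgroup.inf_relIndex_right]
  intro h0
  have hdvd : D.PiX.relIndex D.DeltaCbar ∣ D.PiX.index := Subgroup.relIndex_dvd_index_of_normal _ _
  rw [h0, D.index_piX, zero_dvd_iff] at hdvd
  exact absurd hdvd (by norm_num)

/-- `[Δ_X̲ : modLKer] ≠ 0 ⟹ [Δ_C̲ : modLKer] ≠ 0`. ([IUTchI] §1 p.37) [claim: Mochizuki2012, status: disputed] -/
theorem modLKer_relIndex_deltaCbar_ne_zero (hfi : D.modLKer.relIndex D.DeltaXbar ≠ 0) :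
    D.modLKer.relIndex D.DeltaCbar ≠ 0 :=
  Subgroup.relIndex_ne_zero_trans hfi D.deltaXbar_relIndex_deltaCbar_ne_zero

/-- `[Δ_X̲ : modLKer] < ∞` ⟹ **`galKer` (the inverse image of `Gal(X̲/C̲)` in `Δ_C̲`) is CLOSED**
(`modLKer ≤ galKer ≤ Δ_C̲`). ([IUTchI] §1 p.38) [claim: Mochizuki2012, status: disputed] -/
theorem isClosed_galKer_of_relIndex_ne_zero (hfi : D.modLKer.relIndex D.DeltaXbar ≠ 0) :
    IsClosed (D.galKer : Set D.PiC) :=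
  ArrowOpen.isClosed_of_le_of_relIndex_ne_zero D.modLKer_le_galKer D.isClosed_modLKer
    fun h0 => D.modLKer_relIndex_deltaCbar_ne_zero hfi
      (Subgroup.relIndex_eq_zero_of_le_right D.galKer_le_deltaCbar h0)

/-- The subgroup generated by the `l`-th powers of `Δ_C̲` is normalised by `Π_C̲` (conjugation by `Π_C̲`
preserves `Δ_C̲ = Π_C̲ ∩ Δ_C` and commutes with `l`-th powers). ([IUTchI] §1 p.38)
[claim: Mochizuki2012, status: disputed] -/
theorem lPowClosure_normal_subgroupOf :
    ((Subgroup.closure ((fun y : D.PiC => y ^ D.l) '' (D.DeltaCbar : Set D.PiC))).subgroupOf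
      D.PiCbar).Normal := by
  refine ⟨fun n hn g => ?_⟩
  rw [Subgroup.mem_subgroupOf] at hn ⊢
  have hsub : (MulAut.conj (g : D.PiC)) '' ((fun y : D.PiC => y ^ D.l) '' (D.DeltaCbar : Set D.PiC)) ⊆
      (fun y : D.PiC => y ^ D.l) '' (D.DeltaCbar : Set D.PiC) := by
    rintro _ ⟨_, ⟨y, hy, rfl⟩, rfl⟩
    refine ⟨MulAut.conj (g : D.PiC) y, ⟨?_, ?_⟩, by simp [map_pow]⟩
    · rw [MulAut.conj_apply]
      exact D.PiCbar.mul_mem (D.PiCbar.mul_mem g.2 hy.1) (D.PiCbar.inv_mem g.2)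
    · rw [MulAut.conj_apply]
      exact D.E.normal_geom.conj_mem _ hy.2 _
  have hm : (MulAut.conj (g : D.PiC)) (n : D.PiC) ∈
      Subgroup.closure ((fun y : D.PiC => y ^ D.l) '' (D.DeltaCbar : Set D.PiC)) := by
    have hm0 := Subgroup.mem_map_of_mem (MulAut.conj (g : D.PiC)).toMonoidHom hn
    rw [MonoidHom.map_closure] at hm0
    exact Subgroup.closure_mono hsub hm0
  simpa [MulAut.conj_apply] using hm

/-- `galKer` is normalised by `Π_C̲` as soon as `jKer` is (claim `jKer_normal` of p. 38).
([IUTchI] §1 p.38) [claim: Mochizuki2012, status: disputed] -/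
theorem galKer_normal_subgroupOf (hnorm : (D.jKer.subgroupOf D.PiCbar).Normal) :
    (D.galKer.subgroupOf D.PiCbar).Normal := by
  have hjC : D.jKer ≤ D.PiCbar :=
    D.jKer_le_deltaXbar.trans (D.deltaXbar_le_piXbar.trans D.piXbar_le_piCbar)
  have hS : Subgroup.closure ((fun y : D.PiC => y ^ D.l) '' (D.DeltaCbar : Set D.PiC)) ≤ D.PiCbar := by
    rw [Subgroup.closure_le]
    rintro _ ⟨y, hy, rfl⟩
    exact D.PiCbar.pow_mem hy.1 _
  haveI := D.lPowClosure_normal_subgroupOf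
  show ((D.jKer ⊔ Subgroup.closure ((fun y : D.PiC => y ^ D.l) '' (D.DeltaCbar : Set D.PiC))).subgroupOf
    D.PiCbar).Normal
  rw [Subgroup.subgroupOf_sup hjC hS]
  infer_instance

/-- `Π_{C→} = D_{2ε} · galKer` is CLOSED as soon as `galKer` is closed, `D_{2ε}` is closed and normalises
`galKer`. ([IUTchI] §1 p.38) [claim: Mochizuki2012, status: disputed] -/
theorem isClosed_piCarrow_of_isClosed (hg : IsClosed (D.galKer : Set D.PiC))
    (hdec : IsClosed (D.decomp D.twoε : Set D.PiC))
    (hnorm : D.decomp D.twoε ≤ Subgroup.normalizer (D.galKer : Set D.PiC)) :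
    IsClosed (D.piCarrow : Set D.PiC) := by
  have h : ((D.decomp D.twoε ⊔ D.galKer : Subgroup D.PiC) : Set D.PiC) =
      (D.decomp D.twoε : Set D.PiC) * (D.galKer : Set D.PiC) :=
    Subgroup.coe_mul_of_left_le_normalizer_right _ _ hnorm
  change IsClosed ((D.decomp D.twoε ⊔ D.galKer : Subgroup D.PiC) : Set D.PiC)
  rw [h]
  exact hg.smul_left_of_isCompact hdec.isCompact

/-- A CLOSED `Π_{C→}` of finite index in `Π_C̲` (claim `piCarrow_relindex`: the index is `l`) is OPEN in
`Π_C`. ([IUTchI] §1 p.38) [claim: Mochizuki2012, status: disputed] -/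
theorem isOpen_piCarrow_of_isClosed (hcl : IsClosed (D.piCarrow : Set D.PiC))
    (hrel : D.piCarrow.relIndex D.PiCbar ≠ 0) : IsOpen (D.piCarrow : Set D.PiC) := by
  haveI : Finite (D.PiC ⧸ D.PiCbar) := Subgroup.quotient_finite_of_isOpen _ D.isOpen_piCbar
  have h1 : D.PiCbar.index ≠ 0 := Subgroup.index_ne_zero_of_finite
  have h2 : D.piCarrow.index ≠ 0 := by
    rw [← Subgroup.relIndex_mul_index D.piCarrow_le_piCbar]
    exact mul_ne_zero hrel h1
  haveI : D.piCarrow.FiniteIndex := ⟨h2⟩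
  exact D.piCarrow.isOpen_of_isClosed_of_finiteIndex hcl

/-- **`Π_{C→} ⊆ Π_C` is OPEN**, from: `jKer` normalised by `Π_C̲`, `[Π_C̲ : Π_{C→}] ≠ 0`,
`[Δ_X̲ : modLKer] ≠ 0` and closedness of `D_{2ε}`. ([IUTchI] §1 p.38 "open immersions of profinite groups")
[claim: Mochizuki2012, status: disputed] -/
theorem isOpen_piCarrow_of (hnorm : (D.jKer.subgroupOf D.PiCbar).Normal)
    (hrel : D.piCarrow.relIndex D.PiCbar ≠ 0) (hfi : D.modLKer.relIndex D.DeltaXbar ≠ 0)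
    (hdec : IsClosed (D.decomp D.twoε : Set D.PiC)) : IsOpen (D.piCarrow : Set D.PiC) := by
  have hn : D.decomp D.twoε ≤ Subgroup.normalizer (D.galKer : Set D.PiC) :=
    ((D.decomp_le D.twoε).trans D.piXbar_le_piCbar).trans
      ((Subgroup.normal_subgroupOf_iff_le_normalizer D.galKer_le_piCbar').mp
        (D.galKer_normal_subgroupOf hnorm))
  exact D.isOpen_piCarrow_of_isClosed
    (D.isClosed_piCarrow_of_isClosed (D.isClosed_galKer_of_relIndex_ne_zero hfi) hdec hn) hrel

/-- **`Π_{C→} ⊆ Π_C` is OPEN** under the printed claims of p. 38 (`ArrowCoveringClaims`), topological finite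
generation of `Δ_X̲`, and closedness of `D_{2ε}`. ([IUTchI] §1 p.38) [claim: Mochizuki2012, status: disputed] -/
theorem isOpen_piCarrow_of_claims (h : D.ArrowCoveringClaims)
    (htfg : IsTopologicallyFinitelyGenerated ↥D.DeltaXbar)
    (hdec : IsClosed (D.decomp D.twoε : Set D.PiC)) : IsOpen (D.piCarrow : Set D.PiC) :=
  D.isOpen_piCarrow_of h.jKer_normal (by rw [h.piCarrow_relindex]; exact D.l_ne_zero)
    (D.modLKer_relIndex_ne_zero_of_tfg htfg) hdec

/-- **`Π_{C→} ⊆ Π_C` is OPEN** under the printed claims of p. 38, [AbsTopI] Prop. 2.2 for `Δ_C` (`GeomTFG`),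
and closedness of `D_{2ε}`. ([IUTchI] §1 p.38) [claim: Mochizuki2012, status: disputed] -/
theorem isOpen_piCarrow_of_claims_of_geomTFG (h : D.ArrowCoveringClaims) (hΔ : D.E.GeomTFG)
    (hdec : IsClosed (D.decomp D.twoε : Set D.PiC)) : IsOpen (D.piCarrow : Set D.PiC) :=
  D.isOpen_piCarrow_of_claims h (D.tfg_deltaXbar_of_geomTFG hΔ) hdec

end PuncturedEllipticData


end Literature.IUT.HodgeTheaters
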